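import Summits.Ventures.PercRepro2.CaseOneGadgetUWA1MainII
import Summits.Ventures.PercRepro2.CaseOneGadgetUWA1MainIIQ
import Summits.Ventures.PercRepro2.CaseOneGadgetUWA1Pendant
import Summits.Ventures.PercRepro2.CaseOnePendantTreeMarks
import Summits.Ventures.PercRepro2.CaseOneClosedAtIff

/-!
# The gadget `u ~ {w, a₁}`, `w ~ {u, a₂, o, b}` (uwa1): the closed anchor — all four forms, `(J1₁)`, pendant trees
(blind cell PercRepro2, p1 g24; S5 §2.1 (K9): the uwa1 row closed on all four cells; own code)

With the four chain heads `zSplitII_of_gadgetUWA1` / `zSplitIIQ_of_gadgetUWA1` (this seat, the face induction) and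
`zSplitI_of_gadgetUWA1` / `zSplitIQ_of_gadgetUWA1` (g23), a uwa1-gadget vertex has **all four forms for every finite
graph and every weight vector** (`fourForms_of_gadgetUWA1`), hence `(J1₁)` there (`jOneOne_of_gadgetUWA1`, K1); it is a
closed anchor in the sense of the pendant-tree closure (`GadgetUWA1Anchor`, `fourFormsAll_of_gadgetUWA1Anchor`): every
vertex of every pendant tree hanging at a uwa1-gadget vertex has the four forms, `(J1₁)` and — where `P(T′) > 0` —
`(RV)` (`fourForms_of_pendantTree_gadgetUWA1`, `jOneOne_of_pendantTree_gadgetUWA1`, `rv_of_pendantTree_gadgetUWA1`), and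
every instance reachable from a uwa1-gadget vertex by the moves of CaseOneMoves (pendant trees, series–parallel
thickenings, loops) is closed (`closedAt_of_gadgetUWA1Anchor`, `closedAt_of_moves_gadgetUWA1`,
`fourForms_of_moves_gadgetUWA1`).
The pendant lemma K8 on the `(ii)` side at a uwa1-gadget vertex (`zSplitII_of_leaf_gadgetUWA1`,
`zSplitIIQ_of_leaf_gadgetUWA1`, on the pattern of g23's `(i)` side) and the six-edge description
(`zSplitII_of_pendantGadgetUWA1`, `zSplitIIQ_of_pendantGadgetUWA1`, `fourForms_of_pendantGadgetUWA1`,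
`jOneOne_of_pendantGadgetUWA1`) complete the row. The uwa1 shape is not symmetric in the roots (`u ~ a₁`, `w ~ a₂`),
so no `(J1)` (which needs the mirror shape) is claimed. Standard axioms. -/

namespace Summit.Ventures.PercRepro2

namespace CaseOne

universe u

section Vertex
variable {V : Type*} {E : Type*} [Fintype E] [DecidableEq E] [Fintype V] [DecidableEq V]
  {R : Type*} [Field R] [LinearOrder R] [IsStrictOrderedRing R]
variable {ends : E → Sym2 V} {o a₁ a₂ b u w : V} {euw eua1 ewa2 ewo ewb : E}

/-- **All four forms at a uwa1-gadget vertex**, every finite graph, every weight vector. -/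
theorem fourForms_of_gadgetUWA1 (p : E → R) (hp : IsProbVec p)
    (h : IsGadgetUWA1 ends o a₁ a₂ b u w euw eua1 ewa2 ewo ewb) : FourForms p ends o a₁ a₂ u b :=
  ⟨zSplitII_of_gadgetUWA1 p hp h, zSplitIIQ_of_gadgetUWA1 p hp h, zSplitI_of_gadgetUWA1 p hp h,
    zSplitIQ_of_gadgetUWA1 p hp h⟩

/-- **`(J1₁)` at a uwa1-gadget vertex** (K1: `(i)` and `(ii)` give `(J1₁)`). -/
theorem jOneOne_of_gadgetUWA1 (p : E → R) (hp : IsProbVec p)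
    (h : IsGadgetUWA1 ends o a₁ a₂ b u w euw eua1 ewa2 ewo ewb) : JOneOne p ends o a₁ a₂ u b :=
  jOneOne_of_i_of_ii p ends o a₁ a₂ u b (zSplitI_of_gadgetUWA1 p hp h) (zSplitII_of_gadgetUWA1 p hp h)

end Vertex

section Pendant
variable {V : Type*} {E : Type*} [Fintype E] [DecidableEq E] [Fintype V] [DecidableEq V]
  {R : Type*} [Field R] [LinearOrder R] [IsStrictOrderedRing R]
variable {ends : E → Sym2 V} {o a₁ a₂ b u w a₃ : V} {e₀ euw eua1 ewa2 ewo ewb : E}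

/-- **`(ii)` for `a₃` pendant at a uwa1-gadget vertex**: `a₃` is a leaf at `u` (edge `e₀`), and in `G − e₀` the
vertex `u` is a uwa1-gadget vertex; every weight vector (the weight of `e₀` included). -/
theorem zSplitII_of_leaf_gadgetUWA1 (p : E → R) (hp : IsProbVec p) (hl : IsLeafAt ends u a₃ e₀)
    (ho : o ≠ a₃) (h1 : a₁ ≠ a₃) (h2 : a₂ ≠ a₃) (hb : b ≠ a₃)
    {euw eua1 ewa2 ewo ewb : {e : E // e ≠ e₀}}
    (h : IsGadgetUWA1 (restrictEnds ends e₀) o a₁ a₂ b u w euw eua1 ewa2 ewo ewb) :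
    ZSplitII p ends o a₁ a₂ a₃ b :=
  zSplitII_of_leaf_at p hp hl o a₁ a₂ b ho h1 h2 hb
    (zSplitII_of_restrict p hl ho h1 h2 hl.ne hb
      (zSplitII_of_gadgetUWA1 (restrictW p e₀) (IsProbVec.restrictW hp e₀) h))
    (zSplitIIQ_of_restrict p hl ho h1 h2 hl.ne hb
      (zSplitIIQ_of_gadgetUWA1 (restrictW p e₀) (IsProbVec.restrictW hp e₀) h))

/-- **`(ii-Q)` for `a₃` pendant at a uwa1-gadget vertex**: the Q-threshold form scales down the leaf edge. -/
theorem zSplitIIQ_of_leaf_gadgetUWA1 (p : E → R) (hp : IsProbVec p) (hl : IsLeafAt ends u a₃ e₀)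
    (ho : o ≠ a₃) (h1 : a₁ ≠ a₃) (h2 : a₂ ≠ a₃) (hb : b ≠ a₃)
    {euw eua1 ewa2 ewo ewb : {e : E // e ≠ e₀}}
    (h : IsGadgetUWA1 (restrictEnds ends e₀) o a₁ a₂ b u w euw eua1 ewa2 ewo ewb) :
    ZSplitIIQ p ends o a₁ a₂ a₃ b :=
  zSplitIIQ_of_leaf_at p hp hl o a₁ a₂ b ho h1 h2 hb
    (zSplitIIQ_of_restrict p hl ho h1 h2 hl.ne hb
      (zSplitIIQ_of_gadgetUWA1 (restrictW p e₀) (IsProbVec.restrictW hp e₀) h))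

/-- **`(J1₁)` for `a₃` pendant at a uwa1-gadget vertex.** -/
theorem jOneOne_of_leaf_gadgetUWA1 (p : E → R) (hp : IsProbVec p) (hl : IsLeafAt ends u a₃ e₀)
    (ho : o ≠ a₃) (h1 : a₁ ≠ a₃) (h2 : a₂ ≠ a₃) (hb : b ≠ a₃)
    {euw eua1 ewa2 ewo ewb : {e : E // e ≠ e₀}}
    (h : IsGadgetUWA1 (restrictEnds ends e₀) o a₁ a₂ b u w euw eua1 ewa2 ewo ewb) :
    JOneOne p ends o a₁ a₂ a₃ b :=
  jOneOne_of_i_of_ii p ends o a₁ a₂ a₃ b (zSplitI_of_leaf_gadgetUWA1 p hp hl ho h1 h2 hb h)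
    (zSplitII_of_leaf_gadgetUWA1 p hp hl ho h1 h2 hb h)

/-- **`(ii)` for the pendant uwa1 gadget in `G`** (the six-edge description `IsPendantGadgetUWA1At`). -/
theorem zSplitII_of_pendantGadgetUWA1 (p : E → R) (hp : IsProbVec p)
    (h : IsPendantGadgetUWA1At ends o a₁ a₂ b u w a₃ e₀ euw eua1 ewa2 ewo ewb) :
    ZSplitII p ends o a₁ a₂ a₃ b :=
  zSplitII_of_leaf_gadgetUWA1 p hp h.leaf h.ne_o' h.ne_a1' h.ne_a2' h.ne_b' h.gadgetUWA1

/-- **`(ii-Q)` for the pendant uwa1 gadget in `G`.** -/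
theorem zSplitIIQ_of_pendantGadgetUWA1 (p : E → R) (hp : IsProbVec p)
    (h : IsPendantGadgetUWA1At ends o a₁ a₂ b u w a₃ e₀ euw eua1 ewa2 ewo ewb) :
    ZSplitIIQ p ends o a₁ a₂ a₃ b :=
  zSplitIIQ_of_leaf_gadgetUWA1 p hp h.leaf h.ne_o' h.ne_a1' h.ne_a2' h.ne_b' h.gadgetUWA1

/-- **All four forms for the pendant uwa1 gadget in `G`.** -/
theorem fourForms_of_pendantGadgetUWA1 (p : E → R) (hp : IsProbVec p)
    (h : IsPendantGadgetUWA1At ends o a₁ a₂ b u w a₃ e₀ euw eua1 ewa2 ewo ewb) :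
    FourForms p ends o a₁ a₂ a₃ b :=
  ⟨zSplitII_of_pendantGadgetUWA1 p hp h, zSplitIIQ_of_pendantGadgetUWA1 p hp h,
    zSplitI_of_pendantGadgetUWA1 p hp h, zSplitIQ_of_pendantGadgetUWA1 p hp h⟩

/-- **`(J1₁)` for the pendant uwa1 gadget in `G`.** -/
theorem jOneOne_of_pendantGadgetUWA1 (p : E → R) (hp : IsProbVec p)
    (h : IsPendantGadgetUWA1At ends o a₁ a₂ b u w a₃ e₀ euw eua1 ewa2 ewo ewb) :
    JOneOne p ends o a₁ a₂ a₃ b :=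
  jOneOne_of_i_of_ii p ends o a₁ a₂ a₃ b (zSplitI_of_pendantGadgetUWA1 p hp h)
    (zSplitII_of_pendantGadgetUWA1 p hp h)

end Pendant

section AnchorDef
variable {V : Type*}

/-- The uwa1-gadget anchor: `v ~ {w, a₁}` with `w ~ {v, a₂, o, b}` for some unmarked `w`. -/
def GadgetUWA1Anchor (o a₁ a₂ b : V) (E : Type u) (ends : E → Sym2 V) (v : V) : Prop :=
  ∃ (w : V) (euw eua1 ewa2 ewo ewb : E), IsGadgetUWA1 ends o a₁ a₂ b v w euw eua1 ewa2 ewo ewb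

end AnchorDef

section Anchor
variable {V : Type*} [Fintype V] [DecidableEq V] {R : Type*} [Field R] [LinearOrder R]
  [IsStrictOrderedRing R]

variable (o a₁ a₂ b : V)

/-- A uwa1-gadget anchor has the four forms. -/
theorem fourForms_of_gadgetUWA1Anchor (E : Type u) [Fintype E] [DecidableEq E] (ends : E → Sym2 V)
    (p : E → R) (hp : IsProbVec p) (v : V) (h : GadgetUWA1Anchor o a₁ a₂ b E ends v) :
    FourForms p ends o a₁ a₂ v b := by
  obtain ⟨w, euw, eua1, ewa2, ewo, ewb, h⟩ := h
  exact fourForms_of_gadgetUWA1 p hp h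

/-- A uwa1-gadget anchor is closed for every weight vector: `FourFormsAll`. -/
theorem fourFormsAll_of_gadgetUWA1Anchor (E : Type u) [Fintype E] [DecidableEq E] (ends : E → Sym2 V)
    (v : V) (h : GadgetUWA1Anchor o a₁ a₂ b E ends v) : FourFormsAll R o a₁ a₂ b E ends v := by
  intro _ _ p hp
  exact fourForms_of_gadgetUWA1Anchor o a₁ a₂ b E ends p hp v h


/-- A uwa1-gadget anchor is closed: `ClosedAt`. -/
theorem closedAt_of_gadgetUWA1Anchor (E : Type u) [Fintype E] [DecidableEq E] (ends : E → Sym2 V)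
    (v : V) (h : GadgetUWA1Anchor o a₁ a₂ b E ends v) : ClosedAt R o a₁ a₂ b E ends v :=
  fun p hp => fourForms_of_gadgetUWA1Anchor o a₁ a₂ b E ends p hp v h

/-- **Every instance reachable by moves from a uwa1-gadget vertex is closed.** -/
theorem closedAt_of_moves_gadgetUWA1 {E' : Type u} [Fintype E'] [DecidableEq E'] {ends' : E' → Sym2 V}
    {v' : V} (h' : GadgetUWA1Anchor o a₁ a₂ b E' ends' v') {E : Type u} [Fintype E] [DecidableEq E]
    {ends : E → Sym2 V} {v : V} (h : Moves o a₁ a₂ b E' ends' v' E ends v) :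
    ClosedAt R o a₁ a₂ b E ends v :=
  closedAt_of_moves h (closedAt_of_gadgetUWA1Anchor o a₁ a₂ b E' ends' v' h')

/-- The four forms for one weight vector on every instance reachable by moves from a uwa1-gadget vertex. -/
theorem fourForms_of_moves_gadgetUWA1 {E' : Type u} [Fintype E'] [DecidableEq E'] {ends' : E' → Sym2 V}
    {v' : V} (h' : GadgetUWA1Anchor o a₁ a₂ b E' ends' v') {E : Type u} [Fintype E] [DecidableEq E]
    {ends : E → Sym2 V} {v : V} (h : Moves o a₁ a₂ b E' ends' v' E ends v) (p : E → R)
    (hp : IsProbVec p) : FourForms p ends o a₁ a₂ v b :=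
  closedAt_of_moves_gadgetUWA1 o a₁ a₂ b h' h p hp

variable {E : Type u} [Fintype E] [DecidableEq E] {ends : E → Sym2 V} {v a₃ y : V} {S : Set V} {n : ℕ}

/-- **The four forms at the end of a pendant path of any length at a uwa1-gadget vertex**, every finite
graph, every weight vector. -/
theorem fourForms_of_pendantPath_gadgetUWA1 (p : E → R) (hp : IsProbVec p)
    (h : IsPendantPathAt (GadgetUWA1Anchor o a₁ a₂ b) o a₁ a₂ b n E ends v a₃) :
    FourForms p ends o a₁ a₂ a₃ b :=
  fourForms_of_pendantPath (GadgetUWA1Anchor o a₁ a₂ b) o a₁ a₂ b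
    (fourForms_of_gadgetUWA1Anchor o a₁ a₂ b) n E ends p hp v a₃ h

/-- **`(RV)` at the end of a pendant path of any length at a uwa1-gadget vertex** (where `P(T′) > 0`). -/
theorem rv_of_pendantPath_gadgetUWA1 (p : E → R) (hp : IsProbVec p)
    (h : IsPendantPathAt (GadgetUWA1Anchor o a₁ a₂ b) o a₁ a₂ b n E ends v a₃)
    (hT : 0 < prob p (Tp ends a₁ a₂ a₃)) : RV p ends o a₁ a₂ a₃ b :=
  rv_of_pendantPath (GadgetUWA1Anchor o a₁ a₂ b) (fourForms_of_gadgetUWA1Anchor o a₁ a₂ b) p hp h hT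

/-- **The four forms at every vertex of every pendant tree hanging at a uwa1-gadget vertex**, every finite
graph, every weight vector. -/
theorem fourForms_of_pendantTree_gadgetUWA1 (p : E → R) (hp : IsProbVec p)
    (h : IsPendantTreeAt (GadgetUWA1Anchor o a₁ a₂ b) o a₁ a₂ b n E ends v S) (hy : y ∈ S) :
    FourForms p ends o a₁ a₂ y b :=
  fourForms_of_pendantTree (GadgetUWA1Anchor o a₁ a₂ b) o a₁ a₂ b
    (fourForms_of_gadgetUWA1Anchor o a₁ a₂ b) n E ends p hp v S h y hy

/-- **`(J1₁)` at every vertex of every pendant tree hanging at a uwa1-gadget vertex.** -/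
theorem jOneOne_of_pendantTree_gadgetUWA1 (p : E → R) (hp : IsProbVec p)
    (h : IsPendantTreeAt (GadgetUWA1Anchor o a₁ a₂ b) o a₁ a₂ b n E ends v S) (hy : y ∈ S) :
    JOneOne p ends o a₁ a₂ y b :=
  jOneOne_of_i_of_ii p ends o a₁ a₂ y b (fourForms_of_pendantTree_gadgetUWA1 o a₁ a₂ b p hp h hy).2.2.1
    (fourForms_of_pendantTree_gadgetUWA1 o a₁ a₂ b p hp h hy).1

/-- **`(RV)` at every vertex of every pendant tree hanging at a uwa1-gadget vertex** (where `P(T′) > 0`). -/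
theorem rv_of_pendantTree_gadgetUWA1 (p : E → R) (hp : IsProbVec p)
    (h : IsPendantTreeAt (GadgetUWA1Anchor o a₁ a₂ b) o a₁ a₂ b n E ends v S) (hy : y ∈ S)
    (hT : 0 < prob p (Tp ends a₁ a₂ y)) : RV p ends o a₁ a₂ y b :=
  rv_of_pendantTree (GadgetUWA1Anchor o a₁ a₂ b) (fourForms_of_gadgetUWA1Anchor o a₁ a₂ b) p hp h hy hT

end Anchor

end CaseOne

end Summit.Ventures.PercRepro2
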